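import Summits.SmoothPoincare4.SmoothPoincare4.Theses.SymplecticOrigami
import Summits.SmoothPoincare4.SmoothPoincare4.Theorems.NoGenusTwoDoor.Negative.NoncompactDoor
import Literature.AlgebraicTopology.SingularHomology.SingularChains
import Literature.Geometry.Kaehler.ManifoldFormsPullback
import Literature.Geometry.Symplectic.SteinDomain

/-!
# Skeleton line `canonical-cap-filling` for crux `NoGenusTwoDoor` (stmt-SmoothPoincare4-7842)

Route `SymplecticOrigami`, crux r2 `NoGenusTwoDoor` (D, the DOOR: no closed connected symplectic
4-manifold `(N, s)` has `(b₁, b₂) = (2, 1)`).  Idea card `Ideas/canonical-cap-filling.md`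
(crux-ideate r1, ideator 2; triage r1-1/2/3: PASS ×3, merged with `liouville-genus-two-complement`
≈ `semidefinite-filling-door` into the FILLING line; sharpenings adopted below), standing
disprover `Cruxes/NoGenusTwoDoor/Disproof.lean` v3 (gen 2, cycle 2; read 2026-08-16 incl. §7–§10).

THE LINE.  On a door the rank-one lattice `H₂(N)/Tors = ℤh`, `h² = +1`, makes Taubes' canonical
curve `B` (`[B] = K = h`, genus 2, `B·B = 1`; STUB S1, the route's foreseen layer-2 input
`DoorHasCanonicalGenusTwoCurve`) automatically Poincaré dual to the symplectic class, so the open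
complement `U = N ∖ B` is EXACT (`s|_U = dθ`) and FLAT (`H₂(U; ℤ) → H₂(N; ℤ)` is torsion-valued,
i.e. `Q_W ⊗ ℚ ≡ 0` for `W = N ∖ ν(B)`) — STUB S2, rank-one linear algebra + de Rham.  By
McLean / Diogo–Lisi the exact complement of a symplectic divisor is a LIOUVILLE DOMAIN `(W, λ)`
(tree `IsLiouvilleDomain`) whose convex boundary is the Euler-number-`(−1)` circle bundle over
`Σ₂` with its Boothby–Wang contact structure, `(Y_{2,−1}, ξ_BW) = Σ(2,5,10)` — STUB S3 (packaging).
The crux is thereby TRANSFERRED (losslessly: STUB S5 + `flatFillingExclusion_iff`, kernel-checked)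
to the Betti-free, filling-language statement STUB S4 = C⁺ (HARDEST):
  FLAT FILLING EXCLUSION — no closed symplectic 4-manifold contains a symplectic genus-2 surface of
  square `+1` whose complement is exact, flat and Liouville-packaged; equivalently (capping /
  uncapping with the canonical concave cap `ν(B) ≅ D₊₁(Σ₂)`): the genus-2 Boothby–Wang boundary
  `(Y_{2,−1}, ξ_BW)` has NO exact filling `W` with `Q_W ⊗ ℚ ≡ 0`.
It mentions neither `b₁`, `b₂`, Kodaira dimension nor `b⁺ > 1` technology, and it is where
3+1-dimensional tools act (ECH/HM cobordism maps of the exact cobordism through the CANONICAL cap,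
the `Λ*H₁(Y)`-twisted sectors carrying the door's loop counts, neck-stretching against the known
fillings, Chen-type classification under `Q ≡ 0`).

REGISTERED STUBS (5; sorries only inside `stub_*`):
* `stub_taubesCanonicalCurve`   [S1, XL]  door ⇒ embedded symplectic genus-2 `B` with meridian
  injectivity `H₁(N ∖ B) ↪ H₁(N)` (⟺ `B·B = 1`).  Taubes `SW ⇒ Gr` at `b⁺ = 1` in the `s`-chamber,
  chamber-free because the cup product `H¹ ⊗ H¹ → H²` vanishes at `b₂ = 1` (triage F4, proved in a
  seat folder), adjunction.  Uses `[CompactSpace N]` — honours `Negative…false_without_compact`.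
* `stub_rankOneFlatComplement`  [S2, M/L]  closed symplectic `(N, s)` with `rank H₂ = 1` and a
  symplectic surface `B` ⇒ `s` exact on `N ∖ B` and `N ∖ B` flat in `N`.  `[s] = λ·PD[B]`,
  `PD[B]|_{N∖B} = 0`, de Rham theorem on the open manifold; `z·B = 0` for cycles off `B`.
* `stub_liouvillePackaging`     [S3, L]   McLean 2012 / Diogo–Lisi 2019 §2: exact symplectic-divisor
  complements are Liouville domains (tree `IsLiouvilleDomain`), embedded as `N` minus an
  arbitrarily thin tube around `B`, `ι^* s = dλ`.
* `stub_flatFillingExclusion`   [S4, HARDEST, open ⟺ crux]  the transfer target C⁺ above.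
* `stub_closingUp`              [S5, M/L]  the card's first lemma `GenusTwoPinsDoor`, generalised:
  a symplectic genus-2 `B` with meridian injectivity and flat complement forces
  `(b₁, b₂)(N) = (2, 1)` (Thom isomorphism, unimodularity, adjunction, `c₁² = 2χ + 3σ`) — the
  CONVERSE hinge: any flat exact filling found (e.g. by the weinstein-door Legendrian search) IS a
  door, and `FlatFillingExclusion ↔ NoGenusTwoDoor` given S1, S2, S3 (`flatFillingExclusion_iff`).

`NoGenusTwoDoor_of` composes S1 → S2 → S3 → S4 into the crux BY NAME (pure logic, no `sorry`); S5
enters the proved converse `flatFillingExclusion_of_noGenusTwoDoor`.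

Disproof used (`Cruxes/NoGenusTwoDoor/Disproof.lean` v3): §5 `false_withoutCompact` = landed
`Theorems/NoGenusTwoDoor/Negative/NoncompactDoor.noGenusTwoDoor_false_without_compact` (p74187,
IMPORTED here, `example` below): every stub keeps `[CompactSpace N]`; on the witness
`T*T² = (ℝ² ∖ 0)²` S1 already fails (an exact form has no closed symplectic surface), S2/S5 use
Poincaré duality of the CLOSED `N`, S3 needs the compact domain.  §5 `false_withoutClosed` /
non-degeneracy: S1 uses `ds = 0` and `s ∧ s > 0` essentially (Taubes), and `IsClosedForm` is never
detached from `IsSmoothForm` (§1 caveat) — the bundled `IsSymplecticMForm` below carries all three.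
§4 `filling_numerics` and §9 `complement_bookkeeping` are the arithmetic shadow of S2/S5
(`closingUp_arith`, `complement_euler` below re-derive the integers); §10 (cycle 2, NEW): exact
fillings of `(Y_{2,−1}, ξ_BW)` with `b₁ = 2` EXIST (`W_k = ((T² × S²) # k\overline{ℂP²}) ∖ ν(B)`,
`k ≥ 1`, `b⁻(W_k) = k + 1`) — they are NOT flat (`Q ≠ 0`), so S4 is stated with FLATNESS, not
`b₁ = 2`, as its load-bearing hypothesis (`ruled_controls_not_flat` below), and `W₃` passing Chen's
T.1–T.3 is recorded in the line card as the reason "infinite capacity" cannot corner the door.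
§2 `adjunction_no_tori` / `posDef_no_isotropic` are available to S4's prover (no spheres, no
essential square-≤0 classes on the capped side).  Negatives index for SmoothPoincare4: empty
(2026-08-16); no stub is an instance of a refuted statement; the refuted strengthenings recorded by
triage (C⁺⁺ "cup non-torsion at b⁺ = 1, b₁ = 2" — Nil⁴/Γ, Baldridge `X_g`; "no Q ≡ 0 exact filling
of any `Y_{g,e}`" — `ℂP² ∖ cubic` at `(1, −9)`; the HF membership test and the bare ECH
multiplicity-support test — void on the Milnor fibre) are stubbed NOWHERE: S4 is pinned to
`(g, B·B) = (2, 1)` with flatness.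
-/

noncomputable section

-- the prescribed namespace `Summit.<P>.<Sub>.…` duplicates `SmoothPoincare4` (P = Sub)
set_option linter.dupNamespace false

open scoped Manifold ContDiff Topology ContinuousMap
open Set Function TopologicalSpace
open Literature.Geometry.Kaehler (MForm IsSmoothForm IsClosedForm mextDeriv)
open Literature.AlgebraicTopology.SingularHomology
open Literature.Topology.FourManifolds (singularHomologyZ)
open Summit.SmoothPoincare4.SmoothPoincare4.Theses.SymplecticOrigami (NoGenusTwoDoor)

namespace Summit.SmoothPoincare4.SmoothPoincare4.Cruxes.NoGenusTwoDoor.CanonicalCapFilling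

/-- Model space `ℝⁿ`. -/
local notation "𝔼" n:arg => EuclideanSpace ℝ (Fin n)

/-! ### Vocabulary (local abbreviations over tree declarations; nothing new is posited) -/

/-- `(N, s)` is symplectic in the tree's `MForm` vocabulary: `s` chartwise smooth, closed, and
pointwise non-degenerate — the crux's three form hypotheses bundled (same text as Disproof §0
`IsSymplecticMForm`; `IsClosedForm` is never used without `IsSmoothForm`, Disproof §1). -/
def IsSymplecticMForm {N : Type*} [TopologicalSpace N] [ChartedSpace (𝔼 4) N]
    (s : MForm (𝓡 4) N ℝ 2) : Prop :=
  IsSmoothForm s ∧ IsClosedForm s ∧ ∀ x (v : TangentSpace (𝓡 4) x), v ≠ 0 → ∃ w, s x ![v, w] ≠ 0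

/-- `b : S → N` is a smoothly embedded `s`-SYMPLECTIC surface: a `C^∞` embedding whose pulled-back
form `b^* s` is non-degenerate on `S` (same clauses as the route items `OrigamiRung`,
`McDuffWendlAffinePair`). -/
def IsSymplecticSurface {N : Type*} [TopologicalSpace N] [ChartedSpace (𝔼 4) N]
    (s : MForm (𝓡 4) N ℝ 2) {S : Type*} [TopologicalSpace S] [ChartedSpace (𝔼 2) S]
    (b : S → N) : Prop :=
  Manifold.IsSmoothEmbedding (𝓡 2) (𝓡 4) ∞ b ∧
    ∀ y (v : TangentSpace (𝓡 2) y), v ≠ 0 →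
      ∃ w : TangentSpace (𝓡 2) y, s (b y) ![mfderiv (𝓡 2) (𝓡 4) b y v, mfderiv (𝓡 2) (𝓡 4) b y w] ≠ 0

/-- The inclusion of the complement of a subset, as a continuous map (for the homology functor). -/
def complIncl (N : Type*) [TopologicalSpace N] (B : Set N) : C(↥Bᶜ, N) :=
  ⟨Subtype.val, continuous_subtype_val⟩

/-- MERIDIAN INJECTIVITY of `B ⊂ N`: `H₁(N ∖ B; ℤ) → H₁(N; ℤ)` is injective.  By the Thom–Gysin
sequence `H₂(N) →(·B) ℤ → H₁(N ∖ B) → H₁(N) → 0` of a closed connected oriented surface `B` in a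
closed oriented 4-manifold this says: some class meets `B` algebraically once — for `b₂(N) = 1`
(`H₂/Tors = ℤh`, `h² = 1`, `[B] = m h`) exactly `m = 1`, i.e. `B·B = +1` and `[B]` generates.
(The sibling line `Cruxes/OrigamiRung/Lines/rank-one-integrality-pinch.lean` calls the order of
this kernel `meridianOrder`; here only its vanishing is needed.) -/
def MeridianInjective (N : Type*) [TopologicalSpace N] (B : Set N) : Prop :=
  Function.Injective (singularHomology.map ℤ ℤ (complIncl N B) 1)

/-- FLATNESS of the complement: every integral 2-cycle of `N ∖ B` is TORSION in `H₂(N; ℤ)`, i.e.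
`H₂(N ∖ B; ℚ) → H₂(N; ℚ)` vanishes.  For `W = N ∖ ν(B) ≃ N ∖ B` this is `Q_W ⊗ ℚ ≡ 0`
("flat filling": vanishing rational intersection form), the card's hypothesis on the filling. -/
def IsFlat (N : Type*) [TopologicalSpace N] (B : Set N) : Prop :=
  ∀ x, IsOfFinAddOrder (singularHomology.map ℤ ℤ (complIncl N B) 2 x)

/-- EXACTNESS of `s` on an open submanifold `U ⊆ N`: `s|_U = dθ` for a smooth 1-form `θ` on `U`
(restriction = pull-back along the inclusion, tree `MForm.pullback`; `d` = tree `mextDeriv`). -/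
def IsExactOn {N : Type*} [TopologicalSpace N] [ChartedSpace (𝔼 4) N]
    (s : MForm (𝓡 4) N ℝ 2) (U : Opens N) : Prop :=
  ∃ θ : MForm (𝓡 4) U ℝ 1, IsSmoothForm θ ∧ mextDeriv θ = s.pullback (𝓡 4) (Subtype.val : U → N)

/-- LIOUVILLE PACKAGING of the complement of `B` in `(N, s)` (the conclusion of McLean's lemma, as
a hypothesis schema): for every open `V ⊇ B` there is a compact connected LIOUVILLE DOMAIN
`(W, λ)` (tree `Literature.Geometry.Symplectic.IsLiouvilleDomain`: `λ` smooth, `dλ` non-degenerate,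
Liouville field outward along `∂W`) and an injective immersion `ι : W → N` of the compact manifold
with boundary (hence an embedding) with `N ∖ V ⊆ ι(W) ⊆ N ∖ B` and `ι^* s = dλ`.  Intended
instance: `W = N ∖ ν_ε(B)` for a thin symplectic disc-bundle neighbourhood, `λ|_{∂W}` the
Boothby–Wang connection form of `∂W = −∂ν(B) ≅ Y_{g,−B·B}`. -/
def HasLiouvillePackaging {N : Type} [TopologicalSpace N] [ChartedSpace (𝔼 4) N]
    (s : MForm (𝓡 4) N ℝ 2) (B : Set N) : Prop :=
  ∀ V : Set N, IsOpen V → B ⊆ V →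
    ∃ (W : Type) (_ : TopologicalSpace W) (_ : T2Space W) (_ : SecondCountableTopology W)
      (_ : CompactSpace W) (_ : ConnectedSpace W) (_ : ChartedSpace (EuclideanHalfSpace 4) W)
      (_ : IsManifold (𝓡∂ 4) ∞ W) (lam : MForm (𝓡∂ 4) W ℝ 1) (ι : W → N),
      Literature.Geometry.Symplectic.IsLiouvilleDomain W lam ∧
      ContMDiff (𝓡∂ 4) (𝓡 4) ∞ ι ∧ Function.Injective ι ∧
      (∀ x, Function.Injective (mfderiv (𝓡∂ 4) (𝓡 4) ι x)) ∧
      Set.range ι ⊆ Bᶜ ∧ Vᶜ ⊆ Set.range ι ∧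
      mextDeriv lam = s.pullback (𝓡∂ 4) ι

/-! ### The arithmetic of the hinge (PROVED; integer shadows of S2/S5 and of the controls) -/

/-- CLOSING-UP ARITHMETIC (the integer core of S5 = card `GenusTwoPinsDoor`): in the rank-one odd
lattice (`h² = 1`) let `[B] = m h`, `K ≡ k h`; meridian injectivity gives `m = 1`, adjunction for
the genus-2 symplectic `B` reads `2·2 − 2 = m² + k m`, and `k² = K² = 2χ + 3σ = 2(3 − 2b₁) + 3`.
Then `b₁ = 2`.  (Without `m = 1` the other root `(m, k) = (2, −1)` survives numerically — it is
Liu's `K·ω < 0 ⇒` rational/ruled case, excluded here by hypothesis, not by gauge theory.)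
[folklore] -/
theorem closingUp_arith {m k b₁ : ℤ} (hm : m = 1) (hadj : 2 * 2 - 2 = m * m + k * m)
    (hk : k * k = 2 * (2 - 2 * b₁ + 1) + 3 * 1) : b₁ = 2 := by
  subst hm
  have hk1 : k = 1 := by omega
  subst hk1
  omega

/-- The numerically possible `(m, k)` for a genus-2 symplectic class `m h` at `b₂ = 1` (`2 = m² + km`,
`k` odd since `K` is characteristic for the odd form `⟨1⟩`, `m > 0` by positive area): exactly
`(1, 1)` — the door, `K = h = [B]` — or `(2, −1)`. [folklore] -/
theorem genusTwo_roots {m k : ℤ} (hm : 0 < m) (hadj : 2 = m * m + k * m) (hodd : Odd k) :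
    (m = 1 ∧ k = 1) ∨ (m = 2 ∧ k = -1) := by
  have h2 : 2 = m * (m + k) := by rw [mul_add, mul_comm m k]; exact hadj
  have hm2 : m ≤ 2 := Int.le_of_dvd (by norm_num) ⟨m + k, h2⟩
  rcases hodd with ⟨j, rfl⟩
  interval_cases m <;> omega

/-- COMPLEMENT EULER NUMBER (Disproof §4/§9 re-derived): `χ(W) = χ(N) − χ(B) = (3 − 2b₁) − (2 − 2g)`;
for the door (`b₁ = 2`, `g = 2`) `χ(W) = 1`, and capping a filling with `χ(W) = 1`, `b₁ = 2`
returns `χ = −1`, `b₂ = 1`. [folklore] -/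
theorem complement_euler {b₁ g χW : ℤ} (hb : b₁ = 2) (hg : g = 2)
    (hχ : χW = (2 - 2 * b₁ + 1) - (2 - 2 * g)) : χW = 1 ∧ χW - 2 = 2 - 2 * b₁ + 1 := by
  subst hb hg; omega

/-- CONTROLS ARE NOT FLAT (why S4 carries flatness, not `b₁(W) = 2`; Disproof §10, triage F2/N3):
a closed symplectic host with `b₂ = 1 + n`, `n ≥ 1` — `(T² × S²) # k\overline{ℂP²}` (`n = k + 1`,
exact fillings `W_k` with `b₁ = 2`), the ruled surface `Σ₂ ×~ S²` (`n = 1`, the Stein disc bundle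
`D₋₁(Σ₂)`), `ℂP² # 12\overline{ℂP²}` (`n = 12`) — leaves `b⁻(W) = n ≥ 1` negative classes in the
complement of a square-`(+1)` curve carrying `b⁺`, so `Q_W ≠ 0`: none of them is a flat filling,
while each is exact. [folklore] -/
theorem ruled_controls_not_flat {n bpos bneg : ℤ} (hn : 1 ≤ n) (hsum : bpos + bneg = 1 + n)
    (hpos : bpos = 1) : bneg ≠ 0 := by
  omega

/-! ### The five stub STATEMENTS (named `Prop`s; the registered `stub_*` theorems below restate them
verbatim, and `Registered.stub_*` are their name-keyed aliases used as hypotheses of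
`NoGenusTwoDoor_of` — same device as `Cruxes/OrigamiRung/Lines/rank-one-integrality-pinch.lean`) -/

/-- Statement of STUB S1 [Taubes canonical curve]. -/
def TaubesCanonicalCurve : Prop :=
  ∀ (N : Type) [TopologicalSpace N] [T2Space N] [SecondCountableTopology N] [CompactSpace N]
    [ConnectedSpace N] [ChartedSpace (𝔼 4) N] [IsManifold (𝓡 4) ∞ N] (s : MForm (𝓡 4) N ℝ 2),
    IsSymplecticMForm s →
    Module.finrank ℤ (singularHomologyZ N 1) = 2 → Module.finrank ℤ (singularHomologyZ N 2) = 1 →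
    ∃ (S : Type) (_ : TopologicalSpace S) (_ : T2Space S) (_ : CompactSpace S) (_ : ConnectedSpace S)
      (_ : ChartedSpace (𝔼 2) S) (_ : IsManifold (𝓡 2) ∞ S) (b : S → N),
      Module.finrank ℤ (singularHomologyZ S 1) = 4 ∧ IsSymplecticSurface s b ∧
        MeridianInjective N (Set.range b)

/-- Statement of STUB S2 [rank-one flat complement]. -/
def RankOneFlatComplement : Prop :=
  ∀ (N : Type) [TopologicalSpace N] [T2Space N] [SecondCountableTopology N] [CompactSpace N]
    [ConnectedSpace N] [ChartedSpace (𝔼 4) N] [IsManifold (𝓡 4) ∞ N] (s : MForm (𝓡 4) N ℝ 2)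
    (S : Type) [TopologicalSpace S] [T2Space S] [CompactSpace S] [ConnectedSpace S]
    [ChartedSpace (𝔼 2) S] [IsManifold (𝓡 2) ∞ S] (b : S → N),
    IsSymplecticMForm s → Module.finrank ℤ (singularHomologyZ N 2) = 1 → IsSymplecticSurface s b →
    (∀ U : Opens N, (U : Set N) = (Set.range b)ᶜ → IsExactOn s U) ∧ IsFlat N (Set.range b)

/-- Statement of STUB S3 [Liouville packaging]. -/
def LiouvillePackaging : Prop :=
  ∀ (N : Type) [TopologicalSpace N] [T2Space N] [SecondCountableTopology N] [CompactSpace N]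
    [ConnectedSpace N] [ChartedSpace (𝔼 4) N] [IsManifold (𝓡 4) ∞ N] (s : MForm (𝓡 4) N ℝ 2)
    (S : Type) [TopologicalSpace S] [T2Space S] [CompactSpace S] [ConnectedSpace S]
    [ChartedSpace (𝔼 2) S] [IsManifold (𝓡 2) ∞ S] (b : S → N) (U : Opens N),
    IsSymplecticMForm s → IsSymplecticSurface s b → (U : Set N) = (Set.range b)ᶜ →
    IsExactOn s U → HasLiouvillePackaging s (Set.range b)

/-- Statement of STUB S4 [flat filling exclusion] — the transfer target C⁺ (Betti-free). -/
def FlatFillingExclusion : Prop :=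
  ∀ (N : Type) [TopologicalSpace N] [T2Space N] [SecondCountableTopology N] [CompactSpace N]
    [ConnectedSpace N] [ChartedSpace (𝔼 4) N] [IsManifold (𝓡 4) ∞ N] (s : MForm (𝓡 4) N ℝ 2)
    (S : Type) [TopologicalSpace S] [T2Space S] [CompactSpace S] [ConnectedSpace S]
    [ChartedSpace (𝔼 2) S] [IsManifold (𝓡 2) ∞ S] (b : S → N) (U : Opens N),
    IsSymplecticMForm s → Module.finrank ℤ (singularHomologyZ S 1) = 4 →
    IsSymplecticSurface s b → (U : Set N) = (Set.range b)ᶜ → MeridianInjective N (Set.range b) →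
    IsExactOn s U → IsFlat N (Set.range b) → HasLiouvillePackaging s (Set.range b) → False

/-- Statement of STUB S5 [closing up] — the card's first lemma `GenusTwoPinsDoor`, generalised. -/
def ClosingUp : Prop :=
  ∀ (N : Type) [TopologicalSpace N] [T2Space N] [SecondCountableTopology N] [CompactSpace N]
    [ConnectedSpace N] [ChartedSpace (𝔼 4) N] [IsManifold (𝓡 4) ∞ N] (s : MForm (𝓡 4) N ℝ 2)
    (S : Type) [TopologicalSpace S] [T2Space S] [CompactSpace S] [ConnectedSpace S]
    [ChartedSpace (𝔼 2) S] [IsManifold (𝓡 2) ∞ S] (b : S → N),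
    IsSymplecticMForm s → Module.finrank ℤ (singularHomologyZ S 1) = 4 →
    IsSymplecticSurface s b → MeridianInjective N (Set.range b) → IsFlat N (Set.range b) →
    Module.finrank ℤ (singularHomologyZ N 1) = 2 ∧ Module.finrank ℤ (singularHomologyZ N 2) = 1

/-! ### The registered stubs -/

/-- STUB S1 [TAUBES CANONICAL CURVE] (the route's foreseen layer-2 input
`DoorHasCanonicalGenusTwoCurve`; = `Cruxes/NoGenusTwoDoor/SketchIdeator3.lean`
`door_has_symplectic_genus_two_surface` + meridian injectivity; SHARED with the semidefinite /
liouville lines — staff once).  A door `(N, s)` — closed connected symplectic with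
`(rank H₁, rank H₂) = (2, 1)` — contains a smoothly embedded compact connected `s`-symplectic
surface `B = b(S)` of genus 2 (`rank H₁(S) = 4`) with `H₁(N ∖ B; ℤ) → H₁(N; ℤ)` injective
(⟺ `B·B = +1`, `[B]` generates `H₂(N)/Tors`).  Proof in print: `b₂ = 1`, `[s]² > 0` ⇒ `b⁺ = 1`,
`b⁻ = 0`, `H₂/Tors = ℤh`, `h² = 1`, `K ≡ kh`, `k² = 2χ + 3σ = 1`; the cup product
`H¹ ⊗ H¹ → H²` vanishes (`b₂ = 1`: `(a∪b)² = −a²b² = 0` and a square-zero class in a definite line is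
`0` — `IdeatorOne.DoorCupOneOneVanishes` / `Ideator3.cupProduct_H1_eq_zero_of_b2_eq_one`, PROVED over
`ℚ` by triage r1-3 F4 from `cupProduct_gradedComm_holds` + `isPerfPair_cupPairing_of_field_holds`),
so every Li–Liu / Okonek–Teleman wall-crossing number `½⟨(a∪b)∪c, [N]⟩` of the `b⁺ = 1`,
`b₁ = 2` manifold is ZERO and `SW(𝔰_K) = ±SW(𝔰_can) = ±1` in the `s`-chamber (Taubes 1994;
conjugation symmetry); Taubes' `SW ⇒ Gr` for `b⁺ = 1` (Taubes 1996/2000, Li–Liu 1999) then gives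
an embedded, possibly disconnected, symplectic curve `C = ⊔ Cⱼ` with `[C] = PD⁻¹ K` through
`d(K) = 0` points; each `[Cⱼ] = mⱼ h + tⱼ` has `mⱼ ≥ 1` (positive area, `[s] = λh`, `λ > 0`), and
`Σ mⱼ = |k| = 1` forces ONE component with `m = 1`, `k = +1` (`K·[s] > 0`; the `k = −1` branch would
be a curve of negative area); genus by adjunction `2g − 2 = C² + K·C = 2`; meridian injectivity from
`h·B = 1` (Thom–Gysin).  Why it might fail: not mathematically (each input is a theorem in print for
closed symplectic `b⁺ = 1` manifolds; the `b⁺ = 1` version of `SW ⇒ Gr` needs the `s`-chamber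
bookkeeping, printed in Li–Liu 1999 / McDuff–Salamon survey) — it fails only as a FORMAL task:
no Seiberg–Witten or Gromov–Taubes theory in Lean (XL); vendor as cite facts
(`taubes_swGr_bPlusOne`, `liLiu_wallCrossing_b1two`) plus the proved cup lemma.  Uses
`[CompactSpace N]` essentially (Disproof §5 witness `T*T²`: exact form, no symplectic closed
surface at all).  Cheapest falsifier: none cheaper than the crux (a door without a genus-2 curve
contradicts Taubes); sanity: on the near-door `(S¹×S³)#(S¹×S³)#ℂP²` (not symplectic) the class `h`
IS represented by a smooth genus-2 surface in a ball — consistent, S1 is about `s`.  Sources: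
Taubes1994 (doi:10.4310/MRL.1994.v1.n6.a15), Taubes1996 (SW⇒Gr, doi:10.1090/S0894-0347-96-00211-1),
LiLiu1995 (wall crossing, doi:10.4310/MRL.1995.v2.n6.a13), Li–Liu 1999 (b⁺ = 1 SW = Gr, IMRN 1999
no. 7, 335–345), OkonekTeleman1996 (doi:10.1142/s0129167x96000438), Liu1996, LiLiu2001,
McDuffSalamon2017 §13.3 (adjunction), card canonical-cap-filling, SketchIdeator3.  Size: XL. -/
theorem stub_taubesCanonicalCurve :
    ∀ (N : Type) [TopologicalSpace N] [T2Space N] [SecondCountableTopology N] [CompactSpace N]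
      [ConnectedSpace N] [ChartedSpace (𝔼 4) N] [IsManifold (𝓡 4) ∞ N] (s : MForm (𝓡 4) N ℝ 2),
      IsSymplecticMForm s →
      Module.finrank ℤ (singularHomologyZ N 1) = 2 → Module.finrank ℤ (singularHomologyZ N 2) = 1 →
      ∃ (S : Type) (_ : TopologicalSpace S) (_ : T2Space S) (_ : CompactSpace S)
        (_ : ConnectedSpace S) (_ : ChartedSpace (𝔼 2) S) (_ : IsManifold (𝓡 2) ∞ S) (b : S → N),
        Module.finrank ℤ (singularHomologyZ S 1) = 4 ∧ IsSymplecticSurface s b ∧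
          MeridianInjective N (Set.range b) := by
  sorry

/-- STUB S2 [RANK-ONE FLAT COMPLEMENT] ("why it bites HERE": only at `b₂ = 1` is the canonical curve
automatically `s`-dual; M mathematically, L/XL formally).  For a closed connected symplectic
`(N, s)` with `rank H₂(N; ℤ) = 1` and ANY smoothly embedded compact connected `s`-symplectic surface
`B = b(S)`: (i) `s` is EXACT on the open complement `U = N ∖ B` (`s|_U = dθ`, `θ` smooth), and
(ii) `U` is FLAT in `N` (integral 2-cycles of `U` are torsion in `H₂(N)`).  Proof: `H₂(N)/Tors = ℤh`
unimodular, `[s]_ℝ = λ·PD(h)`, `∫_B s > 0` ⇒ `[B] = mh + t`, `m ≠ 0`, and `λ²h² = ∫ s² > 0` ⇒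
`h² = +1`; (ii) a 2-cycle `z ⊂ U` misses `B`, so `z·B = 0` (the intersection pairing of disjointly
supported classes vanishes: `PD[B]` is the image of the Thom class of `ν(B)`, supported near `B`),
`[z] = ah + t'` with `am = 0` ⇒ `a = 0`; (i) `PD[B]_ℝ|_U ∈ H²(U; ℝ) ≅ Hom(H₂(U; ℝ), ℝ)` (UCT over
a field) pairs every `z` to `z·B = 0`, so `PD[B]_ℝ|_U = 0`, hence `[s]|_U = (λ/m')·PD[B]_ℝ|_U = 0`
in `H²(U; ℝ) ≅ H²_dR(U)` (de Rham's theorem for the open 4-manifold `U`, tree named fact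
`exists_deRhamIsoFamily` / `finrank_deRhamCohomology_eq_bettiNumber`), i.e. `s|_U = dθ`.
Equivalent packaging: `IdeatorOne.RankOnePullbackVanishes` (rank-one linear algebra, triage: true).
Why it might fail: only by mis-typing — `IsExactOn` asks for a smooth GLOBAL primitive on the open
submanifold `U` (true by de Rham, not just "closed with zero periods"); `IsFlat` is over `ℤ` modulo
torsion (intended: `Tors H₂(N)` may be non-zero on a door).  Uses compactness (Poincaré duality,
finite generation) and non-degeneracy/closedness of `s` (`[s]² > 0`, `∫_B s > 0`).  Cheapest
falsifier: (ℂP², line): `U = ℂ²` — `ω_FS|_{ℂ²} = dd^c log(1+|z|²)` exact ✓, `H₂(ℂ²) = 0` flat ✓;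
(ℂP², conic): `U ≅ T*ℝP²`, `H₂(U; ℤ) = 0` flat ✓, exact ✓ (its meridian kernel is `ℤ/2`, `m = 2`: S1's
injectivity correctly fails there); fake projective plane ∖ any symplectic curve ✓.
Leans on: `Literature.AlgebraicTopology.SingularHomology.{PoincareDuality, IntersectionForm
(isPerfPair_intersectionForm), GysinMap, AlexanderDualityFacts, LefschetzDuality}`,
`Literature.Geometry.Kaehler.{deRhamCohomology, exists_deRhamIsoFamily}`,
`MForm.pullback_subtypeVal_apply`, `mextDeriv_pullback_apply`.  Sources: BottTu1982 §I.5–I.6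
(Poincaré duality, Thom class), HatcherAT2002 §3.3, MilnorStasheff1974 §9–§11, McDuffSalamon2017
§13.3; cards canonical-cap-filling ("Why it bites here"), liouville-genus-two-complement
(`RankOnePullbackVanishes`); Disproof §9 (`[ω]|_W = 0`, `Q_W ≡ 0`).  Size: M (L/XL formal). -/
theorem stub_rankOneFlatComplement :
    ∀ (N : Type) [TopologicalSpace N] [T2Space N] [SecondCountableTopology N] [CompactSpace N]
      [ConnectedSpace N] [ChartedSpace (𝔼 4) N] [IsManifold (𝓡 4) ∞ N] (s : MForm (𝓡 4) N ℝ 2)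
      (S : Type) [TopologicalSpace S] [T2Space S] [CompactSpace S] [ConnectedSpace S]
      [ChartedSpace (𝔼 2) S] [IsManifold (𝓡 2) ∞ S] (b : S → N),
      IsSymplecticMForm s → Module.finrank ℤ (singularHomologyZ N 2) = 1 → IsSymplecticSurface s b →
      (∀ U : Opens N, (U : Set N) = (Set.range b)ᶜ → IsExactOn s U) ∧ IsFlat N (Set.range b) := by
  sorry

/-- STUB S3 [LIOUVILLE PACKAGING] (a theorem in print: McLean 2012 Lemma 5.17 ff / Diogo–Lisi 2019
§2.1 "complements of symplectic divisors"; L mathematically, XL formally).  Let `(N, s)` be closed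
connected symplectic, `B = b(S)` a smoothly embedded compact connected `s`-symplectic surface, and
suppose `s` is exact on `U = N ∖ B` (⟺ `[s] = c·PD[B]`, `c > 0`: a symplectic divisor Poincaré
dual to a positive multiple of the symplectic class, `B·B > 0`).  Then the complement is
LIOUVILLE-PACKAGED (`HasLiouvillePackaging`): for every open `V ⊇ B` there is a compact connected
Liouville domain `(W, λ)` in the tree's sense (`IsLiouvilleDomain`: `λ` smooth, `dλ` symplectic,
Liouville field `Z` (`ι_Z dλ = λ`) transversally OUTWARD along `∂W`) embedded by an injective
immersion `ι : W → N` with `N ∖ V ⊆ ι(W) ⊆ N ∖ B` and `ι^* s = dλ`.  Construction (McLean;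
Diogo–Lisi Lemma 2.2–2.4): symplectic neighbourhood theorem — `ν_ε(B)` is the radius-`ε` disc
bundle of the Hermitian line bundle `L = ν_B` (degree `B·B`) with `s = π^*σ_B + d(ρ² α)/2`-type
model, `α` a connection form of curvature `−(2π/area)·σ_B`; on `N ∖ B` the primitive `θ` of `s`
is corrected by an exact term (and a `dφ ∧`-cutoff) to `λ` agreeing with the model primitive
`(ρ² − c')α` near `B`, whose Liouville field `((ρ² − c')/ρ) ∂_ρ` with `c' > ε²` points INTO the
tube, i.e. OUT of `W = N ∖ ν_ε(B)` — the boundary `∂W = −S_ε(L)` is CONVEX, contactomorphic to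
the Boothby–Wang (prequantization) structure on the Euler-number-`(−B·B)` circle bundle over `B`
(for the door: `(Y_{2,−1}, ξ_BW) = Σ(2,5,10)`, triage r1-3 F3); `ε` small puts `ν_ε(B) ⊆ V`.
Why it might fail: as mathematics it does not (published lemma; the only hypothesis, `s`-duality
of `B`, is exactly `IsExactOn`); risks are in the TYPING — `HasLiouvillePackaging` asks for an
abstract `𝓡∂ 4`-manifold `W` with `ι` a `C^∞` injective immersion (the tree has collar/boundary
technology: `Literature.Topology.FourManifolds.BoundaryData`, `ClosedBall`, Stein sublevel domains
`SteinDomainSublevel`, `SteinRegularDomain` — the sublevel-set-as-`𝓡∂ 4`-manifold construction is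
the formal cost), and `IsLiouvilleDomain.outward` is phrased in boundary charts.  Cheapest
falsifier: (ℂP², line, ω_FS): `W = ` round ball `B⁴(r)`, `λ = λ_std`, boundary `(S³, ξ_std) =
Y_{0,−1}` ✓ (this is the g = 0 rung of the route); (Σ₂ ×~ S², S₊): `W = D₋₁(Σ₂)` Stein ✓.
Leans on: `Literature.Geometry.Symplectic.IsLiouvilleDomain` (SteinDomain.lean),
`SteinLiouville`/`SteinLiouvilleField` (model Liouville fields), `MForm.pullback`, `mextDeriv`,
`Literature.Geometry.Symplectic.stdSymplecticMForm` (local model).  Sources: Mclean2012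
(doi:10.1007/s00039-012-0158-7 = arXiv:1011.2542, Lemma 5.17 READ — exact ambient primitive with
negative wrapping ⇒ finite-type convex structure on the divisor complement; Lemma 5.19 — wrapping
`κ = −c/2π < 0` iff the divisor is dual to `c[ω]`, `c > 0`), DiogoLisi2019 (doi:10.1112/topo.12105,
§2, Lemma 2.2–2.4), Giroux 2017 (arXiv:1803.05929, remarks on ideal Liouville domains / Donaldson
divisors), McDuffSalamon2017 Thm 3.4.10 (symplectic neighbourhood), BoothbyWang1958, Geiges2008
§7.2 (prequantization bundles); cards canonical-cap-filling (Lever), liouville-genus-two-complement;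
Disproof §9.  Size: L (XL formal). -/
theorem stub_liouvillePackaging :
    ∀ (N : Type) [TopologicalSpace N] [T2Space N] [SecondCountableTopology N] [CompactSpace N]
      [ConnectedSpace N] [ChartedSpace (𝔼 4) N] [IsManifold (𝓡 4) ∞ N] (s : MForm (𝓡 4) N ℝ 2)
      (S : Type) [TopologicalSpace S] [T2Space S] [CompactSpace S] [ConnectedSpace S]
      [ChartedSpace (𝔼 2) S] [IsManifold (𝓡 2) ∞ S] (b : S → N) (U : Opens N),
      IsSymplecticMForm s → IsSymplecticSurface s b → (U : Set N) = (Set.range b)ᶜ →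
      IsExactOn s U → HasLiouvillePackaging s (Set.range b) := by
  sorry

/-- STUB S4 [FLAT FILLING EXCLUSION] — HARDEST; the TRANSFER TARGET C⁺ of the card, Betti-free and
capped through the CANONICAL cap (open; equivalent to the crux given S1–S3 and S5:
`flatFillingExclusion_iff`).  There is NO closed connected symplectic `(N, s)` containing a smoothly
embedded `s`-symplectic genus-2 surface `B = b(S)` (`rank H₁(S) = 4`) with meridian injectivity
(`B·B = +1`) whose complement `U = N ∖ B` is EXACT, FLAT and LIOUVILLE-PACKAGED.  Uncapped (remove
the concave cap `ν(B) ≅ D₊₁(Σ₂)`, glue it back onto any filling): the Boothby–Wang contact manifold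
`(Y, ξ) := (Y_{2,−1}, ξ_BW)` — Euler-number-`(−1)` circle bundle over `Σ₂` = the link `Σ(2,5,10)` of
`z² = x⁵ + y¹⁰` — has NO exact symplectic filling `(W, dλ)` with `Q_W ⊗ ℚ ≡ 0`.  What the
hypotheses hand the prover (all derived, see S5 / Disproof §9 `complement_bookkeeping`): `b₂(N) = 1`,
`b₁(N) = 2`, `K = PD[B]` so `c₁(W)` is torsion, `b₁(W) = 2`, `H₁(W; ℚ) ≅ H₁(N; ℚ)`, `χ(W) = 1`,
`b⁺(W) = b⁻(W) = 0`, `b₃(W) = 2 − r` with `r = rank(H₁(Y) → H₁(W)) ∈ {0,1,2}` undecided (Weinstein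
only if `r = 2`: sub-line weinstein-door-presentation over `IsSteinDomain`), `H₂(W; ℚ) = im H₂(Y; ℚ)`
(boundary tori), and on the capped side `SW` chamber-free with basic classes `{0, K}`, the rigid
genus-2 curve `B`, NO symplectic spheres and no essential square-`≤ 0` class (Disproof §2
`adjunction_no_tori`, `posDef_no_isotropic`), plus the LOOP FLOOD of card picard-loop-classes
(`Gr(nh)(pt^{…} γ₁γ₂) = ±1`, `n ≥ 2`: J-curves through two loops placed inside `W`).  CONTROLS the
proof must separate from the door BY FLATNESS (each is an honest exact filling of the same
`(Y, ξ)`; Disproof §10, triage r1-1 N2/N3, r1-2, r1-3 F2/F3): `D₋₁(Σ₂)` Stein (`b₁ = 4`, `χ = −2`,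
`Q = (−1)`); `W_k = ((T²×S²)#k\overline{ℂP²}) ∖ ν(B)`, `k ≥ 1` (`b₁ = 2`!, `χ = k+2`, `b⁻ = k+1`;
`W₃` passes Chen 2024 Thm 1 T.1–T.3 yet is not the disc bundle ⇒ INFINITE first capacity occurs two
`χ`-steps above the door — "infinite capacity" alone cannot corner it); `b₁ = 0`: Godeaux ∖ K
(`χ = 13`, `Q = −E₈`), rational `ℂP²#12\overline{ℂP²} ∖ (4H−2E₁−E₂−…−E₁₂)` (`χ = 17`), Kunev
(`χ = 25`), Milnor fibre of `z²=x⁵+y¹⁰` = Horikawa canonical complement (`χ = 37`, `b⁺ = 4`; plane-free,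
`Gr(kK) = 0` for `k ≥ 2` — so the bare ECH "multiplicity ≤ 1 support" test and the HF membership test
are VOID, triage r1-1/r1-3: any functional-analytic obstruction must be run TOGETHER with `Q_W ≡ 0`
and the `Λ*H₁(Y)`-sectors).  One genus down the statement is FALSE in the Fano regime
(`ℂP² ∖ cubic` fills `Y_{1,−9}` with `Q ≡ 0`, triage N3): the proof must use `K·B = +1 > 0`
(general-type cap), visible here as `g = 2 ∧ B·B = 1`.  Proof plans (card + triage, none complete):
(P1) ECH/HM: the exact cobordism `W : (Y, ξ) → ∅` has `Φ_W(∅) = 1`, `Φ_W ∘ U = 0`; closing curves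
through the canonical cap identifies `U^j`-counts on orbit sets of fibre-multiplicity `k` with the
door's `Gr(kh; pts, loops)` — zero on points for `k ≥ 2`, `±1` on the loop sectors — to be
contradicted inside Nelson–Weiler's computation of `ECH(Y_{2,−1}, ξ_BW)` with its `H₁`-action,
using `H₂(W) → H₂(N) = 0` to kill every closed class; (P2) SFT neck-stretching of the flood curves
`C_n` (`n ≥ 2`, through `γ₁, γ₂ ⊂ W`) along `∂ν(B)`: their `Ŵ`-levels are punctured curves with
fibre asymptotics in an exact flat filling — derive an index/energy contradiction from `Q_W ≡ 0`
(planes have index `−4` for generic `J`: B2 of the card); (P3) Chen-type classification (arXiv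
2404.01105 Thm 1) with "finite first capacity" replaced by a consequence of `Q_W ≡ 0 ∧ b₁(W) = 2`
(T.1 contractible fibre is NOT free: the meridian is null-homologous in `W`, not known
null-homotopic).  Why it might fail: it is the crux in filling coordinates — FALSE iff a door
exists (then `W = N ∖ ν(B)` is the counterexample; one Luttinger/torus-surgery-free construction of
a `Q ≡ 0` exact filling of `Σ(2,5,10)`, e.g. a hit in the weinstein card's 2-component Legendrian
search in `#2(S¹×S²)`, refutes it and, by S5, the crux); short of that, every listed tool may be
blind: if ECH/HM cobordism maps of exact fillings of `(Y, ξ)` factor through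
`(H_*(W), Q_W, restriction maps, Spin^c)` then the smooth near-door complement
`W_sm = ((S¹×S³)#(S¹×S³)#ℂP²) ∖ ν(Σ₂)` passes everything (card barrier B1) and the line is as blind as
gauge theory on Σ.  Cheapest falsifier: run (P1)'s formal constraints on the Milnor fibre FIRST
(they must NOT already exclude it — triage says they do not) and on `W₁` (`b₁ = 2`, `Q ≠ 0`: the
mechanism must use `Q ≡ 0` visibly at the step where `W₁` escapes).  Barriers: catalogued
`Literature.Barriers.SmoothPoincare4.*` (GaugeSumBarrierFour, TopologicalBarrierFour,
StableBarrierFour, HCobordismInvariantBarrierFour, TwistedSphereBarrierFour, …) all concern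
invariants of the homotopy sphere Σ and do not bite a statement about fillings of `Σ(2,5,10)`
(triage ×3 agree); the crux-level barriers B1 (smooth realisability of all homological data by
`W_sm`) and B2 (no genus-0 curves: planes close to spheres of `c₁ = −k < 0`) are the live ones and
are recorded above.  Sources: card canonical-cap-filling; NelsonWeiler2023
(doi:10.4310/jsg.2023.v21.n6.a1, ECH of prequantization bundles), HutchingsTaubes2013 (cobordism
maps, arXiv:1111.3324), Chen2024 (arXiv:2404.01105 Thm 1), LiMakYasui (Calabi–Yau caps,
arXiv:1412.3208), Wendl2010 (arXiv:0806.3193), OhtaOno2005 (simple singularities and symplectic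
fillings, doi:10.4310/jdg/1121540338), DorfmeisterLi2010 (relative cone, arXiv:0805.2957),
Stipsicz2002 (doi:10.1016/s0166-8641(00)00105-x, Rem 3.4: the crux as open belief), TJLi2015
(arXiv:1511.04831 §4.3.1), Kotschick2006 (arXiv:math/0504578); Disproof §2, §4, §9, §10; triage
r1-1 (N1–N3), r1-2, r1-3 (F1–F3).  Size: XL / open. -/
theorem stub_flatFillingExclusion :
    ∀ (N : Type) [TopologicalSpace N] [T2Space N] [SecondCountableTopology N] [CompactSpace N]
      [ConnectedSpace N] [ChartedSpace (𝔼 4) N] [IsManifold (𝓡 4) ∞ N] (s : MForm (𝓡 4) N ℝ 2)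
      (S : Type) [TopologicalSpace S] [T2Space S] [CompactSpace S] [ConnectedSpace S]
      [ChartedSpace (𝔼 2) S] [IsManifold (𝓡 2) ∞ S] (b : S → N) (U : Opens N),
      IsSymplecticMForm s → Module.finrank ℤ (singularHomologyZ S 1) = 4 →
      IsSymplecticSurface s b → (U : Set N) = (Set.range b)ᶜ → MeridianInjective N (Set.range b) →
      IsExactOn s U → IsFlat N (Set.range b) → HasLiouvillePackaging s (Set.range b) → False := by
  sorry

/-- STUB S5 [CLOSING UP] (the card's first lemma `GenusTwoPinsDoor`, generalised: `b₂ = 1` is now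
DERIVED from flatness; M mathematically, L/XL formally).  Let `(N, s)` be closed connected
symplectic and `B = b(S)` a smoothly embedded `s`-symplectic genus-2 surface (`rank H₁(S) = 4`)
with meridian injectivity and FLAT complement.  Then `(rank H₁(N), rank H₂(N)) = (2, 1)`: `N` is a
door.  Proof: the pair sequence `H₂(N ∖ B) → H₂(N) → H₂(N, N ∖ B) ≅ H₀(B) ≅ ℤ` (excision + Thom
isomorphism for the oriented normal bundle; `B` is oriented by `b^* s`) with rationally-zero first
map gives `b₂(N) ≤ 1`; meridian injectivity ⟺ the composite `H₂(N) → ℤ` (`x ↦ x·B`) is onto, so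
`b₂(N) = 1`, `H₂/Tors = ℤh` with `h·B = ±1`, `[B] = ±h` up to torsion, unimodularity `h² = ±1`, and
`[s] ∈ ℝ·PD(h)` with `[s]² > 0` ⇒ `h² = +1`, `B·B = 1`, `b⁺ = 1`, `b⁻ = 0`, `σ = 1`; `K ≡ kh` is
characteristic for the odd form, `k` odd; adjunction for the embedded symplectic genus-2 `B`:
`2 = B² + K·B = 1 + k` ⇒ `k = 1`; `k² = K² = c₁² = 2χ + 3σ = 2(3 − 2b₁) + 3` ⇒ `b₁ = 2`
(`closingUp_arith`).  (Exactness is not even needed; conversely it follows: `[s] ∝ PD[B]`.)  Role: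
the CONVERSE hinge — `flatFillingExclusion_of_noGenusTwoDoor` — so that S4 wastes no strength and a
constructed flat filling refutes the crux outright (route KILL CRITERIA).  Why it might fail: only
through conventions (`Module.finrank ℤ` = free rank; orientation of `S` taken from `b^* s` inside
the proof); "provable now" is optimistic (triage r1-3): it needs the Thom isomorphism / tubular
neighbourhoods for smooth surfaces in 4-manifolds, the signature theorem `c₁² = 2χ + 3σ` for almost
complex 4-manifolds and the adjunction EQUALITY for embedded symplectic surfaces — absent from
Mathlib (vendor `c₁²` and adjunction as cite facts; the tree has `intersectionForm`,
`isPerfPair_intersectionForm`, `GysinMap`, `LefschetzDuality`, `sigPos_add_sigNeg_intersectionForm`).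
Cheapest falsifier / tightness: (Σ₂ ×~ S², S₊) — symplectic genus 2, `S₊² = 1`, meridian-injective
(`F·S₊ = 1`), complement `≃ S₋` NOT flat, and indeed `(b₁, b₂) = (4, 2)`: flatness is load-bearing;
the `(m, k) = (2, −1)` root of `genusTwo_roots` is excluded by meridian injectivity, not by Liu's
theorem.  Sources: GompfStipsicz1999 §1.4 (adjunction, Thm 1.4.15 ff), McDuffSalamon2017 (4.1.7) +
Rem 4.1.10 + Ex 4.4.5, MilnorStasheff1974 (Thom), HatcherAT2002 §3.3; card canonical-cap-filling
(`GenusTwoPinsDoor`, triage r1-2/r1-3: true, W.lean rc 0); Disproof §4 `filling_numerics`.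
Size: M (L/XL formal). -/
theorem stub_closingUp :
    ∀ (N : Type) [TopologicalSpace N] [T2Space N] [SecondCountableTopology N] [CompactSpace N]
      [ConnectedSpace N] [ChartedSpace (𝔼 4) N] [IsManifold (𝓡 4) ∞ N] (s : MForm (𝓡 4) N ℝ 2)
      (S : Type) [TopologicalSpace S] [T2Space S] [CompactSpace S] [ConnectedSpace S]
      [ChartedSpace (𝔼 2) S] [IsManifold (𝓡 2) ∞ S] (b : S → N),
      IsSymplecticMForm s → Module.finrank ℤ (singularHomologyZ S 1) = 4 →
      IsSymplecticSurface s b → MeridianInjective N (Set.range b) → IsFlat N (Set.range b) →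
      Module.finrank ℤ (singularHomologyZ N 1) = 2 ∧
        Module.finrank ℤ (singularHomologyZ N 2) = 1 := by
  sorry

/-! ### Consistency: each named statement IS its registered stub (definitionally) -/

theorem taubesCanonicalCurve_holds : TaubesCanonicalCurve := stub_taubesCanonicalCurve
theorem rankOneFlatComplement_holds : RankOneFlatComplement := stub_rankOneFlatComplement
theorem liouvillePackaging_holds : LiouvillePackaging := stub_liouvillePackaging
theorem flatFillingExclusion_holds : FlatFillingExclusion := stub_flatFillingExclusion
theorem closingUp_holds : ClosingUp := stub_closingUp

/-! ### Name-keyed aliases of the five statements (the hypotheses of the composition) -/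
namespace Registered

/-- Alias of `TaubesCanonicalCurve` keyed by the registered stub name. -/
abbrev stub_taubesCanonicalCurve : Prop := TaubesCanonicalCurve
/-- Alias of `RankOneFlatComplement` keyed by the registered stub name. -/
abbrev stub_rankOneFlatComplement : Prop := RankOneFlatComplement
/-- Alias of `LiouvillePackaging` keyed by the registered stub name. -/
abbrev stub_liouvillePackaging : Prop := LiouvillePackaging
/-- Alias of `FlatFillingExclusion` keyed by the registered stub name. -/
abbrev stub_flatFillingExclusion : Prop := FlatFillingExclusion
/-- Alias of `ClosingUp` keyed by the registered stub name. -/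
abbrev stub_closingUp : Prop := ClosingUp

end Registered

/-! ### Glue (proved) -/

/-- The image of a smooth embedding of a compact surface is closed, so its complement is an open
submanifold of `N`. -/
theorem isOpen_compl_range {N : Type*} [TopologicalSpace N] [T2Space N] [ChartedSpace (𝔼 4) N]
    {s : MForm (𝓡 4) N ℝ 2} {S : Type*} [TopologicalSpace S] [CompactSpace S]
    [ChartedSpace (𝔼 2) S] {b : S → N} (hb : IsSymplecticSurface s b) :
    IsOpen (Set.range b)ᶜ :=
  (isCompact_range hb.1.isEmbedding.continuous).isClosed.isOpen_compl

/-- The open complement `N ∖ B` as an `Opens N` (an `ℝ⁴`-charted `C^∞` manifold by Mathlib's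
open-submanifold instances). -/
def complOpens {N : Type*} [TopologicalSpace N] [T2Space N] [ChartedSpace (𝔼 4) N]
    {s : MForm (𝓡 4) N ℝ 2} {S : Type*} [TopologicalSpace S] [CompactSpace S]
    [ChartedSpace (𝔼 2) S] {b : S → N} (hb : IsSymplecticSurface s b) : Opens N :=
  ⟨(Set.range b)ᶜ, isOpen_compl_range hb⟩

/-- **The canonical complement of a door is a flat exact Liouville-packaged complement of a
square-one genus-2 curve** (S1 + S2 + S3, assembled): the forward half of the transfer. -/
theorem door_has_flat_exact_canonical_complement (h1 : TaubesCanonicalCurve)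
    (h2 : RankOneFlatComplement) (h3 : LiouvillePackaging)
    (N : Type) [TopologicalSpace N] [T2Space N] [SecondCountableTopology N] [CompactSpace N]
    [ConnectedSpace N] [ChartedSpace (𝔼 4) N] [IsManifold (𝓡 4) ∞ N] (s : MForm (𝓡 4) N ℝ 2)
    (hs : IsSymplecticMForm s) (hb1 : Module.finrank ℤ (singularHomologyZ N 1) = 2)
    (hb2 : Module.finrank ℤ (singularHomologyZ N 2) = 1) :
    ∃ (S : Type) (_ : TopologicalSpace S) (_ : T2Space S) (_ : CompactSpace S)
      (_ : ConnectedSpace S) (_ : ChartedSpace (𝔼 2) S) (_ : IsManifold (𝓡 2) ∞ S) (b : S → N)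
      (U : Opens N),
      Module.finrank ℤ (singularHomologyZ S 1) = 4 ∧ IsSymplecticSurface s b ∧
        (U : Set N) = (Set.range b)ᶜ ∧ MeridianInjective N (Set.range b) ∧ IsExactOn s U ∧
        IsFlat N (Set.range b) ∧ HasLiouvillePackaging s (Set.range b) := by
  obtain ⟨S, i₁, i₂, i₃, i₄, i₅, i₆, b, hS4, hsurf, hmer⟩ := h1 N s hs hb1 hb2
  obtain ⟨hexact, hflat⟩ := h2 N s S b hs hb2 hsurf
  have hU : ((complOpens hsurf : Opens N) : Set N) = (Set.range b)ᶜ := rfl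
  exact ⟨S, i₁, i₂, i₃, i₄, i₅, i₆, b, complOpens hsurf, hS4, hsurf, hU, hmer, hexact _ hU, hflat,
    h3 N s S b (complOpens hsurf) hs hsurf hU (hexact _ hU)⟩

/-! ### The composition: S1 → S2 → S3 → S4 imply the crux, by name -/

/-- `NoGenusTwoDoor` from the four chained registered stubs, by pure logic: a door carries Taubes'
canonical genus-2 curve with meridian injectivity (S1); at `b₂ = 1` its complement is exact and
flat (S2), hence Liouville-packaged (S3); the flat filling exclusion (S4) forbids exactly this
configuration.  No `sorry` here. -/
theorem NoGenusTwoDoor_of (h1 : Registered.stub_taubesCanonicalCurve)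
    (h2 : Registered.stub_rankOneFlatComplement) (h3 : Registered.stub_liouvillePackaging)
    (h4 : Registered.stub_flatFillingExclusion) : NoGenusTwoDoor := by
  intro N _ _ _ _ _ _ _ s hsm hcl hnd hdoor
  obtain ⟨hb1, hb2⟩ := hdoor
  have hs : IsSymplecticMForm s := ⟨hsm, hcl, hnd⟩
  obtain ⟨S, _, _, _, _, _, _, b, U, hS4, hsurf, hU, hmer, hex, hflat, hpack⟩ :=
    door_has_flat_exact_canonical_complement h1 h2 h3 N s hs hb1 hb2
  exact h4 N s S b U hs hS4 hsurf hU hmer hex hflat hpack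

/-- Wiring check: the registered stubs feed `NoGenusTwoDoor_of` as stated. -/
example : NoGenusTwoDoor :=
  NoGenusTwoDoor_of stub_taubesCanonicalCurve stub_rankOneFlatComplement stub_liouvillePackaging
    stub_flatFillingExclusion

/-! ### The converse (S5): no strength is wasted — the transfer is an equivalence -/

/-- **Closing up**: the crux implies the flat filling exclusion (given S5), since a flat,
meridian-injective genus-2 configuration closes up to a door. -/
theorem flatFillingExclusion_of_noGenusTwoDoor (h5 : Registered.stub_closingUp)
    (hD : NoGenusTwoDoor) : FlatFillingExclusion := by
  intro N _ _ _ _ _ _ _ s S _ _ _ _ _ _ b U hs hS4 hsurf _hU hmer _hex hflat _hpack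
  obtain ⟨hb1, hb2⟩ := h5 N s S b hs hS4 hsurf hmer hflat
  exact hD N s hs.1 hs.2.1 hs.2.2 ⟨hb1, hb2⟩

/-- **The transfer is lossless**: given the three packaging theorems S1–S3 and the closing-up
lemma S5, the Betti-free filling statement C⁺ = `FlatFillingExclusion` is EQUIVALENT to the crux. -/
theorem flatFillingExclusion_iff (h1 : Registered.stub_taubesCanonicalCurve)
    (h2 : Registered.stub_rankOneFlatComplement) (h3 : Registered.stub_liouvillePackaging)
    (h5 : Registered.stub_closingUp) : FlatFillingExclusion ↔ NoGenusTwoDoor :=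
  ⟨fun h4 => NoGenusTwoDoor_of h1 h2 h3 h4, flatFillingExclusion_of_noGenusTwoDoor h5⟩

/-! ### Disproof honoured (imported negative lemma) and sanity instances -/

/-- `[CompactSpace N]` is load-bearing for the crux (landed negative lemma, p74187, IMPORTED): the
line keeps it in every stub and consumes it first at S1 (on the witness `T*T² = (ℝ² ∖ 0)² ⊂ ℝ⁴`
the form is exact, so no closed symplectic surface exists and S1's conclusion is impossible). -/
example : ¬ ∀ (N : Type) [TopologicalSpace N] [T2Space N] [SecondCountableTopology N]
    [ConnectedSpace N] [ChartedSpace (EuclideanSpace ℝ (Fin 4)) N] [IsManifold (𝓡 4) ∞ N]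
    (s : MForm (𝓡 4) N ℝ 2), IsSmoothForm s → IsClosedForm s →
    (∀ x (v : TangentSpace (𝓡 4) x), v ≠ 0 → ∃ w, s x ![v, w] ≠ 0) →
    ¬ (Module.finrank ℤ (singularHomologyZ N 1) = 2 ∧ Module.finrank ℤ (singularHomologyZ N 2) = 1) :=
  Summit.SmoothPoincare4.SmoothPoincare4.Theorems.NoGenusTwoDoor.Negative.noGenusTwoDoor_false_without_compact

/-- Sanity (door tuple, Disproof §2 `door_numerics` / §4 `filling_numerics`): `(m, k, b₁) = (1, 1, 2)`
satisfies the hypotheses of `closingUp_arith`, and the capped filling numerics return the door. -/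
example : (2 : ℤ) = 2 := closingUp_arith (m := 1) (k := 1) rfl (by norm_num) (by norm_num)

/-- Sanity (tightness of meridian injectivity): the numerical ghost `(m, k) = (2, −1)` is a root of
the genus-2 adjunction at `b₂ = 1` and is removed only by `m = 1`. -/
example : ((2 : ℤ) = 1 ∧ (-1 : ℤ) = 1) ∨ ((2 : ℤ) = 2 ∧ (-1 : ℤ) = -1) :=
  genusTwo_roots (m := 2) (k := -1) (by norm_num) (by norm_num) ⟨-1, by norm_num⟩

/-- Sanity (controls): the `b₁ = 2` exact fillings `W_k` of Disproof §10 (`n = k + 1 ≥ 2`) and the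
Stein disc bundle `D₋₁(Σ₂)` (`n = 1`) have `b⁻ ≠ 0`, hence are not flat — they do not instantiate
S4's hypotheses. -/
example : (2 : ℤ) ≠ 0 := ruled_controls_not_flat (n := 2) (bpos := 1) (by norm_num) (by norm_num) rfl

end Summit.SmoothPoincare4.SmoothPoincare4.Cruxes.NoGenusTwoDoor.CanonicalCapFilling

end
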